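import Summits.AtomisticToContinuum.Crystallization.Theorems.FreeSplittingCertificatesStrictSplittingRuleP1HatFirstMoment
import Summits.AtomisticToContinuum.Crystallization.Theorems.FreeSplittingCertificatesStrictSplittingRuleP1HatSecondMoment
import Summits.AtomisticToContinuum.Crystallization.Theorems.FreeSplittingCertificatesStrictSplittingRuleP1BareWeight

/-!
# `StrictSplittingRule` (stmt-AtomisticToContinuum-12560): the VERTEX STAR of the quarter triangulation as an averaging device — star radius, mass, monotone and polynomial star integrals (P1 interpolant object, part 80)

Route `FreeSplittingCertificates`, crux r3 `StrictSplittingRule` (H12⋆ = `stub_coreJointCoercive`), unit b2b-freesplit-B gen 36.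
VALUE = kernel bricks for the (S) TAIL LEMMA (HOME FAR-LEMMA-SPEC §20 (c)/(e)(3)): hypothesis (S) of `coreJointCoercive_cell_of_certificates₈`
(per-site domination off the reach set) is an infinite family of inequalities; its far tail is an expansion of the hat-averages
`Σ_{T ∋ q} ∫_T λ_q(y) f(y − y_p) dy` of the radial weights around `y_q`, controlled by the star's ZEROTH, FIRST (`p1Hat_firstMoment`, part 25) and
SECOND (`p1Hat_secondMoment`, part 25c) moments and by the STAR RADIUS.  This file supplies, in the incidence form of `p1SiteBare`
(cells `(q − o, π)` with `p1VertOff (p1Par (q − o)) π m = o`):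
* `fpSq_starOffset_le_even/odd`, **`p1Star_vertex_fpSq_le`**, **`fpSq_sub_le_of_mem_starCell`** — every vertex, hence every point, of a star
  cell of `q` satisfies `|y − y_q|² ≤ 4a²/3 + h²` (the octahedron diagonal; extracted from the edge multiset `p1Star_sum_offsets` by a
  sum-of-nonnegatives argument, then Jensen on the cell);
* **`p1Hat_mass`** — `Σ_{incidences} ∫_T λ_q = √3a²h/2` (`= V_site`; 24 incidences);
* **`p1Star_setIntegral_mono`** — monotonicity of the star integral under a pointwise inequality on the star cells;
* **`p1Star_setIntegral_poly`** — the star integral of `c₀ + ⟪c₁, y − y_q⟫ + (y − y_q)ᵀC(y − y_q)` in closed form (mass, first moment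
  `(√3a²h/240)·W(q)`, second-moment matrix `(√3a²h/2)·Σ₂`);
* `p1SiteBare_const_eq_star` — `p1SiteBare a h W (fun _ => z) q` is the star integral of `y ↦ q_{W(y)}(z)`.
NOT a proof of H12⋆, NOT summit progress.  [folklore: P1 finite elements]
-/

noncomputable section

open Set Function Metric MeasureTheory Filter Topology
open scoped BigOperators NNReal ENNReal

namespace Summit.AtomisticToContinuum.Crystallization.Theorems.StrictSplittingRuleBirth

open Summit.AtomisticToContinuum.Crystallization.Theorems.PalmUnimodularRigidity.LayeredLawsSelectHcp
  (hcpSite hcpSite_apply_zero hcpSite_apply_one hcpSite_apply_two)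
open Literature.MathematicalPhysics.StatisticalMechanics (haggLabel alternatingHagg haggLabel_alternating)

/-! ## The star radius -/

/-- Squared lengths of the star's edge offsets, EVEN layer: each is `0`, `a²`, `a²/3 + h²` or `4a²/3 + h²`, hence `≤ 4a²/3 + h²`. -/
theorem fpSq_starOffset_le_even (a h : ℝ) {qk : ℤ} (hk : Even qk) (qi qj : ℤ) :
    ∀ d ∈ ({(-1, -1, 0), (-1, 0, -1), (-1, 0, 0), (-1, 1, -1), (0, -1, 0), (0, -1, 1), (0, 0, -1), (0, 0, 0), (0, 0, 1), (0, 1, -1),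
        (0, 1, 0), (1, -1, 0), (1, 0, -1), (1, 0, 0), (1, 1, -1)} : Finset (ℤ × ℤ × ℤ)),
      fpSq (fun k => hcpSite a h ((qk, qi, qj) + d) k - hcpSite a h (qk, qi, qj) k) ≤ 4 * a ^ 2 / 3 + h ^ 2 := by
  have h3 : √3 * √3 = 3 := Real.mul_self_sqrt (by norm_num)
  have hk1 : ¬Even (qk + 1) := by rw [Int.even_add_one]; exact not_not.2 hk
  have hk2 : ¬Even (qk + -1) := by rw [← sub_eq_add_neg, Int.even_sub_one]; exact not_not.2 hk
  have ha2 := sq_nonneg a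
  have hh2 := sq_nonneg h
  intro d hd
  simp only [Finset.mem_insert, Finset.mem_singleton] at hd
  rcases hd with rfl | rfl | rfl | rfl | rfl | rfl | rfl | rfl | rfl | rfl | rfl | rfl | rfl | rfl | rfl <;>
    simp [fpSq, hk, hk1, hk2, hcpSite_apply_zero, hcpSite_apply_one, hcpSite_apply_two, haggLabel_alternating] <;>
    nlinarith [h3]

/-- Squared lengths of the star's edge offsets, ODD layer: each `≤ 4a²/3 + h²`. -/
theorem fpSq_starOffset_le_odd (a h : ℝ) {qk : ℤ} (hk : ¬Even qk) (qi qj : ℤ) :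
    ∀ d ∈ ({(-1, -1, 1), (-1, 0, 0), (-1, 0, 1), (-1, 1, 0), (0, -1, 0), (0, -1, 1), (0, 0, -1), (0, 0, 0), (0, 0, 1), (0, 1, -1),
        (0, 1, 0), (1, -1, 1), (1, 0, 0), (1, 0, 1), (1, 1, 0)} : Finset (ℤ × ℤ × ℤ)),
      fpSq (fun k => hcpSite a h ((qk, qi, qj) + d) k - hcpSite a h (qk, qi, qj) k) ≤ 4 * a ^ 2 / 3 + h ^ 2 := by
  have h3 : √3 * √3 = 3 := Real.mul_self_sqrt (by norm_num)
  have hk1 : Even (qk + 1) := by rw [Int.even_add_one]; exact hk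
  have hk2 : Even (qk + -1) := by rw [← sub_eq_add_neg, Int.even_sub_one]; exact hk
  have ha2 := sq_nonneg a
  have hh2 := sq_nonneg h
  intro d hd
  simp only [Finset.mem_insert, Finset.mem_singleton] at hd
  rcases hd with rfl | rfl | rfl | rfl | rfl | rfl | rfl | rfl | rfl | rfl | rfl | rfl | rfl | rfl | rfl <;>
    simp [fpSq, hk, hk1, hk2, hcpSite_apply_zero, hcpSite_apply_one, hcpSite_apply_two, haggLabel_alternating] <;>
    nlinarith [h3]


/-- **THE STAR RADIUS (vertices)**: if vertex `m` of the cell `(q − o, π)` is the site `q`, then every vertex `m'` of that cell is within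
`√(4a²/3 + h²)` of `y_q`: `|y_{m'} − y_q|² ≤ 4a²/3 + h²`.  (From the edge multiset `p1Star_sum_offsets` by a sum-of-nonnegatives argument.) -/
theorem p1Star_vertex_fpSq_le (a h : ℝ) (q : ℤ × ℤ × ℤ) {o : ℤ × ℤ × ℤ} (ho : o ∈ p1Corners) {π : Fin 6} {m : Fin 4}
    (hv : p1VertOff (p1Par (q - o)) π m = o) (m' : Fin 4) :
    fpSq (fun k => hcpSite a h ((q - o) + p1VertOff (p1Par (q - o)) π m') k - hcpSite a h q k) ≤ 4 * a ^ 2 / 3 + h ^ 2 := by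
  classical
  set ρ2 : ℝ := 4 * a ^ 2 / 3 + h ^ 2 with hρ2
  set G : ℤ × ℤ × ℤ → ℝ := fun d => max 0 (fpSq (fun k => hcpSite a h (q + d) k - hcpSite a h q k) - ρ2) with hG
  have hG0 : ∀ d, 0 ≤ G d := fun d => le_max_left _ _
  have hGz : ∀ d, fpSq (fun k => hcpSite a h (q + d) k - hcpSite a h q k) ≤ ρ2 → G d = 0 := fun d hd => by
    simp only [hG]; exact max_eq_left (by linarith)
  -- the weighted edge-multiset sum of `G` vanishes
  have hR : (∑ o ∈ p1Corners, ∑ π : Fin 6, ∑ m : Fin 4,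
      if p1VertOff (p1Par (q - o)) π m = o then ∑ m' : Fin 4, G (p1VertOff (p1Par (q - o)) π m' - o) else 0) = 0 := by
    rw [p1Star_sum_offsets q G]
    obtain ⟨qk, qi, qj⟩ := q
    split_ifs with hk
    · have H := fpSq_starOffset_le_even a h hk qi qj
      simp only [Finset.mem_insert, Finset.mem_singleton, forall_eq_or_imp, forall_eq] at H
      obtain ⟨h1, h2, h3, h4, h5, h6, h7, h8, h9, h10, h11, h12, h13, h14, h15⟩ := H
      rw [hGz _ h1, hGz _ h2, hGz _ h3, hGz _ h4, hGz _ h5, hGz _ h6, hGz _ h7, hGz _ h8, hGz _ h9, hGz _ h10, hGz _ h11,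
        hGz _ h12, hGz _ h13, hGz _ h14, hGz _ h15]
      ring
    · have H := fpSq_starOffset_le_odd a h hk qi qj
      simp only [Finset.mem_insert, Finset.mem_singleton, forall_eq_or_imp, forall_eq] at H
      obtain ⟨h1, h2, h3, h4, h5, h6, h7, h8, h9, h10, h11, h12, h13, h14, h15⟩ := H
      rw [hGz _ h1, hGz _ h2, hGz _ h3, hGz _ h4, hGz _ h5, hGz _ h6, hGz _ h7, hGz _ h8, hGz _ h9, hGz _ h10, hGz _ h11,
        hGz _ h12, hGz _ h13, hGz _ h14, hGz _ h15]
      ring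
  -- every summand is nonnegative, hence the `(o, π, m)` summand vanishes
  have hterm0 : ∀ o' π' m'', 0 ≤ (if p1VertOff (p1Par (q - o')) π' m'' = o' then ∑ m' : Fin 4, G (p1VertOff (p1Par (q - o')) π' m' - o') else 0) :=
    fun o' π' m'' => by split_ifs <;> [exact Finset.sum_nonneg fun _ _ => hG0 _; exact le_rfl]
  have h1 := (Finset.sum_eq_zero_iff_of_nonneg fun o' _ => Finset.sum_nonneg fun π' _ => Finset.sum_nonneg fun m'' _ => hterm0 o' π' m'').1 hR o ho
  have h2 := (Finset.sum_eq_zero_iff_of_nonneg fun π' _ => Finset.sum_nonneg fun m'' _ => hterm0 o π' m'').1 h1 π (Finset.mem_univ _)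
  have h3 := (Finset.sum_eq_zero_iff_of_nonneg fun m'' _ => hterm0 o π m'').1 h2 m (Finset.mem_univ _)
  rw [if_pos hv] at h3
  have h4 := (Finset.sum_eq_zero_iff_of_nonneg fun m₁ _ => hG0 _).1 h3 m' (Finset.mem_univ _)
  have h5 : fpSq (fun k => hcpSite a h (q + (p1VertOff (p1Par (q - o)) π m' - o)) k - hcpSite a h q k) - ρ2 ≤ 0 := by
    have := (max_eq_left_iff.1 h4 : _ ≤ (0:ℝ))
    exact this
  have heq : q + (p1VertOff (p1Par (q - o)) π m' - o) = (q - o) + p1VertOff (p1Par (q - o)) π m' := by abel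
  rw [heq] at h5
  linarith

/-- **THE STAR RADIUS (points)**: every point `y` of a star cell of `q` satisfies `|y − y_q|² ≤ 4a²/3 + h²` (Jensen on the barycentric
representation `y − y_q = Σ_{m'} λ_{m'}(y)(y_{m'} − y_q)`). -/
theorem fpSq_sub_le_of_mem_starCell {a h : ℝ} (ha : a ≠ 0) (hh : h ≠ 0) (q : ℤ × ℤ × ℤ) {o : ℤ × ℤ × ℤ} (ho : o ∈ p1Corners)
    {π : Fin 6} {m : Fin 4} (hv : p1VertOff (p1Par (q - o)) π m = o) {y : Fin 3 → ℝ} (hy : y ∈ p1RealCell a h (q - o, π)) :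
    fpSq (fun k => y k - hcpSite a h q k) ≤ 4 * a ^ 2 / 3 + h ^ 2 := by
  set i : (ℤ × ℤ × ℤ) × Fin 6 := (q - o, π) with hi
  set e : Fin 4 → Fin 3 → ℝ := fun m' k => hcpSite a h (i.1 + p1VertOff (p1Par i.1) i.2 m') k - hcpSite a h q k with he
  have hrep : ∀ k, y k - hcpSite a h q k = ∑ m' : Fin 4, p1Lam a h i m' y * e m' k := by
    intro k
    have h1 := sum_p1Lam_eq_one a h i y
    have h2 := sum_p1Lam_mul_hcpSite ha hh hy k
    simp only [he, mul_sub, Finset.sum_sub_distrib, ← Finset.sum_mul, h1, h2, one_mul]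
  have hj := p1_jensen_sq (fun m' => p1Lam a h i m' y) (fun m' => p1Lam_nonneg_of_mem hy m') (sum_p1Lam_eq_one a h i y) e
  have hv' : ∀ m', e m' 0 ^ 2 + e m' 1 ^ 2 + e m' 2 ^ 2 ≤ 4 * a ^ 2 / 3 + h ^ 2 := fun m' =>
    p1Star_vertex_fpSq_le a h q ho hv m'
  calc fpSq (fun k => y k - hcpSite a h q k)
      = (∑ m', p1Lam a h i m' y * e m' 0) ^ 2 + (∑ m', p1Lam a h i m' y * e m' 1) ^ 2 + (∑ m', p1Lam a h i m' y * e m' 2) ^ 2 := by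
        simp only [fpSq, hrep]
    _ ≤ ∑ m', p1Lam a h i m' y * (e m' 0 ^ 2 + e m' 1 ^ 2 + e m' 2 ^ 2) := hj
    _ ≤ ∑ m', p1Lam a h i m' y * (4 * a ^ 2 / 3 + h ^ 2) :=
        Finset.sum_le_sum fun m' _ => mul_le_mul_of_nonneg_left (hv' m') (p1Lam_nonneg_of_mem hy m')
    _ = 4 * a ^ 2 / 3 + h ^ 2 := by rw [← Finset.sum_mul, sum_p1Lam_eq_one, one_mul]

/-! ## The star mass -/

/-- The star of every site has `24` incidences. -/
theorem p1Star_card (q : ℤ × ℤ × ℤ) :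
    (∑ o ∈ p1Corners, ∑ π : Fin 6, ∑ m : Fin 4, if p1VertOff (p1Par (q - o)) π m = o then (1 : ℝ) else 0) = 24 := by
  have h := p1Star_sum_offsets q (fun _ => (1 : ℝ))
  simp only [Finset.sum_const, Finset.card_univ, Fintype.card_fin, nsmul_eq_mul, Nat.cast_ofNat, mul_one] at h
  have h4 : (∑ o ∈ p1Corners, ∑ π : Fin 6, ∑ m : Fin 4, if p1VertOff (p1Par (q - o)) π m = o then (4 : ℝ) else 0) =
      4 * ∑ o ∈ p1Corners, ∑ π : Fin 6, ∑ m : Fin 4, if p1VertOff (p1Par (q - o)) π m = o then (1 : ℝ) else 0 := by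
    rw [Finset.mul_sum]
    refine Finset.sum_congr rfl fun o _ => ?_
    rw [Finset.mul_sum]
    refine Finset.sum_congr rfl fun π _ => ?_
    rw [Finset.mul_sum]
    refine Finset.sum_congr rfl fun m _ => ?_
    split_ifs <;> norm_num
  have h96 : (∑ o ∈ p1Corners, ∑ π : Fin 6, ∑ m : Fin 4, if p1VertOff (p1Par (q - o)) π m = o then (4 : ℝ) else 0) = 96 := by
    rw [h]; split_ifs <;> norm_num
  linarith

/-- **THE STAR MASS**: `Σ_{incidences (o,π,m) of the star of q} ∫_{cell (q−o,π)} λ_m = √3a²h/2` (`= V_site`, the volume per site: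
24 incidences × `|T|/4`). NOT a proof of H12⋆, NOT summit progress. -/
theorem p1Hat_mass {a h : ℝ} (ha : 0 < a) (hh : 0 < h) (q : ℤ × ℤ × ℤ) :
    (∑ o ∈ p1Corners, ∑ π : Fin 6, ∑ m : Fin 4,
        if p1VertOff (p1Par (q - o)) π m = o then ∫ y in p1RealCell a h (q - o, π), p1Lam a h (q - o, π) m y else 0) =
      √3 * a ^ 2 * h / 2 := by
  have hc := p1Star_card q
  have hrw : (∑ o ∈ p1Corners, ∑ π : Fin 6, ∑ m : Fin 4,
        if p1VertOff (p1Par (q - o)) π m = o then ∫ y in p1RealCell a h (q - o, π), p1Lam a h (q - o, π) m y else 0) =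
      (√3 * a ^ 2 * h / 48) * ∑ o ∈ p1Corners, ∑ π : Fin 6, ∑ m : Fin 4, if p1VertOff (p1Par (q - o)) π m = o then (1 : ℝ) else 0 := by
    rw [Finset.mul_sum]
    refine Finset.sum_congr rfl fun o _ => ?_
    rw [Finset.mul_sum]
    refine Finset.sum_congr rfl fun π _ => ?_
    rw [Finset.mul_sum]
    refine Finset.sum_congr rfl fun m _ => ?_
    split_ifs
    · rw [setIntegral_p1Lam ha hh, mul_one]
    · rw [mul_zero]
  rw [hrw, hc]
  ring


/-! ## Star sums: bookkeeping -/

/-- Star sums are additive. -/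
theorem p1Star_sum_add (q : ℤ × ℤ × ℤ) (A B : ℤ × ℤ × ℤ → Fin 6 → Fin 4 → ℝ) :
    (∑ o ∈ p1Corners, ∑ π : Fin 6, ∑ m : Fin 4, if p1VertOff (p1Par (q - o)) π m = o then A o π m + B o π m else 0) =
      (∑ o ∈ p1Corners, ∑ π : Fin 6, ∑ m : Fin 4, if p1VertOff (p1Par (q - o)) π m = o then A o π m else 0) +
        ∑ o ∈ p1Corners, ∑ π : Fin 6, ∑ m : Fin 4, if p1VertOff (p1Par (q - o)) π m = o then B o π m else 0 := by
  rw [← Finset.sum_add_distrib]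
  refine Finset.sum_congr rfl fun o _ => ?_
  rw [← Finset.sum_add_distrib]
  refine Finset.sum_congr rfl fun π _ => ?_
  rw [← Finset.sum_add_distrib]
  refine Finset.sum_congr rfl fun m _ => ?_
  split_ifs <;> simp

/-- Constants come out of star sums. -/
theorem p1Star_sum_const_mul (q : ℤ × ℤ × ℤ) (c : ℝ) (A : ℤ × ℤ × ℤ → Fin 6 → Fin 4 → ℝ) :
    (∑ o ∈ p1Corners, ∑ π : Fin 6, ∑ m : Fin 4, if p1VertOff (p1Par (q - o)) π m = o then c * A o π m else 0) =
      c * ∑ o ∈ p1Corners, ∑ π : Fin 6, ∑ m : Fin 4, if p1VertOff (p1Par (q - o)) π m = o then A o π m else 0 := by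
  rw [Finset.mul_sum]
  refine Finset.sum_congr rfl fun o _ => ?_
  rw [Finset.mul_sum]
  refine Finset.sum_congr rfl fun π _ => ?_
  rw [Finset.mul_sum]
  refine Finset.sum_congr rfl fun m _ => ?_
  split_ifs <;> simp

/-- Finite sums come out of star sums. -/
theorem p1Star_sum_finsum {ι : Type*} (s : Finset ι) (q : ℤ × ℤ × ℤ) (A : ι → ℤ × ℤ × ℤ → Fin 6 → Fin 4 → ℝ) :
    (∑ o ∈ p1Corners, ∑ π : Fin 6, ∑ m : Fin 4, if p1VertOff (p1Par (q - o)) π m = o then ∑ i ∈ s, A i o π m else 0) =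
      ∑ i ∈ s, ∑ o ∈ p1Corners, ∑ π : Fin 6, ∑ m : Fin 4, if p1VertOff (p1Par (q - o)) π m = o then A i o π m else 0 := by
  classical
  calc (∑ o ∈ p1Corners, ∑ π : Fin 6, ∑ m : Fin 4, if p1VertOff (p1Par (q - o)) π m = o then ∑ i ∈ s, A i o π m else 0)
      = ∑ o ∈ p1Corners, ∑ π : Fin 6, ∑ m : Fin 4, ∑ i ∈ s, (if p1VertOff (p1Par (q - o)) π m = o then A i o π m else 0) := by
        refine Finset.sum_congr rfl fun o _ => Finset.sum_congr rfl fun π _ => Finset.sum_congr rfl fun m _ => ?_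
        split_ifs <;> simp
    _ = ∑ o ∈ p1Corners, ∑ π : Fin 6, ∑ i ∈ s, ∑ m : Fin 4, (if p1VertOff (p1Par (q - o)) π m = o then A i o π m else 0) :=
        Finset.sum_congr rfl fun o _ => Finset.sum_congr rfl fun π _ => Finset.sum_comm
    _ = ∑ o ∈ p1Corners, ∑ i ∈ s, ∑ π : Fin 6, ∑ m : Fin 4, (if p1VertOff (p1Par (q - o)) π m = o then A i o π m else 0) :=
        Finset.sum_congr rfl fun o _ => Finset.sum_comm
    _ = ∑ i ∈ s, ∑ o ∈ p1Corners, ∑ π : Fin 6, ∑ m : Fin 4, (if p1VertOff (p1Par (q - o)) π m = o then A i o π m else 0) :=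
        Finset.sum_comm

/-- **Monotonicity of the star integral**: a pointwise inequality `f ≤ g` on the star cells of `q` integrates against the (nonnegative) hat
functions. -/
theorem p1Star_setIntegral_mono {a h : ℝ} (ha : 0 < a) (hh : 0 < h) (q : ℤ × ℤ × ℤ) {f g : (Fin 3 → ℝ) → ℝ}
    (hf : Continuous f) (hg : Continuous g)
    (hle : ∀ o ∈ p1Corners, ∀ (π : Fin 6) (m : Fin 4), p1VertOff (p1Par (q - o)) π m = o →
      ∀ y ∈ p1RealCell a h (q - o, π), f y ≤ g y) :
    (∑ o ∈ p1Corners, ∑ π : Fin 6, ∑ m : Fin 4,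
        if p1VertOff (p1Par (q - o)) π m = o then ∫ y in p1RealCell a h (q - o, π), p1Lam a h (q - o, π) m y * f y else 0) ≤
      ∑ o ∈ p1Corners, ∑ π : Fin 6, ∑ m : Fin 4,
        if p1VertOff (p1Par (q - o)) π m = o then ∫ y in p1RealCell a h (q - o, π), p1Lam a h (q - o, π) m y * g y else 0 := by
  refine Finset.sum_le_sum fun o ho => Finset.sum_le_sum fun π _ => Finset.sum_le_sum fun m _ => ?_
  split_ifs with hv
  · have hK := isCompact_p1RealCell ha.ne' hh.ne' (q - o, π)
    have hmeas : MeasurableSet (p1RealCell a h (q - o, π)) := (isClosed_p1RealCell a h (q - o, π)).measurableSet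
    have hcl := continuous_p1Lam a h (q - o, π) m
    exact setIntegral_mono_on ((hcl.mul hf).continuousOn.integrableOn_compact hK)
      ((hcl.mul hg).continuousOn.integrableOn_compact hK) hmeas
      fun y hy => mul_le_mul_of_nonneg_left (hle o ho π m hv y hy) (p1Lam_nonneg_of_mem hy m)
  · exact le_rfl

/-- The cell integral of `λ_m·(c₀ + ⟪c₁,e⟫ + eᵀCe)`, `e = y − y_q`, splits into moments. -/
theorem setIntegral_p1Lam_mul_poly {a h : ℝ} (ha : 0 < a) (hh : 0 < h) (q : ℤ × ℤ × ℤ) (i : (ℤ × ℤ × ℤ) × Fin 6) (m : Fin 4)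
    (c₀ : ℝ) (c₁ : Fin 3 → ℝ) (C : Fin 3 → Fin 3 → ℝ) :
    (∫ y in p1RealCell a h i, p1Lam a h i m y *
        (c₀ + fpDot c₁ (fun k => y k - hcpSite a h q k) + p1Quad3 C (fun k => y k - hcpSite a h q k))) =
      c₀ * (∫ y in p1RealCell a h i, p1Lam a h i m y) +
      ∑ k : Fin 3, c₁ k * (∫ y in p1RealCell a h i, p1Lam a h i m y * (y k - hcpSite a h q k)) +
      ∑ k : Fin 3, ∑ l : Fin 3, C k l * (∫ y in p1RealCell a h i, p1Lam a h i m y * ((y k - hcpSite a h q k) * (y l - hcpSite a h q l))) := by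
  have hK := isCompact_p1RealCell ha.ne' hh.ne' i
  have hcl := continuous_p1Lam a h i m
  have hI : ∀ {φ : (Fin 3 → ℝ) → ℝ}, Continuous φ → IntegrableOn (fun y => p1Lam a h i m y * φ y) (p1RealCell a h i) volume :=
    fun hφ => (hcl.mul hφ).continuousOn.integrableOn_compact hK
  have hc1 : ∀ k : Fin 3, Continuous fun y : Fin 3 → ℝ => y k - hcpSite a h q k := fun k => by fun_prop
  have hsplit : (fun y => p1Lam a h i m y *
        (c₀ + fpDot c₁ (fun k => y k - hcpSite a h q k) + p1Quad3 C (fun k => y k - hcpSite a h q k))) =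
      fun y => (c₀ * p1Lam a h i m y + ∑ k : Fin 3, c₁ k * (p1Lam a h i m y * (y k - hcpSite a h q k))) +
        ∑ k : Fin 3, ∑ l : Fin 3, C k l * (p1Lam a h i m y * ((y k - hcpSite a h q k) * (y l - hcpSite a h q l))) := by
    funext y
    simp only [fpDot, p1Quad3, Fin.sum_univ_three]
    ring
  rw [hsplit]
  have i0 : IntegrableOn (fun y => c₀ * p1Lam a h i m y) (p1RealCell a h i) volume :=
    (continuous_const.mul hcl).continuousOn.integrableOn_compact hK
  have i1 : ∀ k : Fin 3, IntegrableOn (fun y => c₁ k * (p1Lam a h i m y * (y k - hcpSite a h q k))) (p1RealCell a h i) volume :=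
    fun k => (hI (hc1 k)).const_mul _
  have i2 : ∀ k l : Fin 3, IntegrableOn (fun y => C k l * (p1Lam a h i m y * ((y k - hcpSite a h q k) * (y l - hcpSite a h q l))))
      (p1RealCell a h i) volume := fun k l => (hI ((hc1 k).mul (hc1 l))).const_mul _
  have i1s : IntegrableOn (fun y => ∑ k : Fin 3, c₁ k * (p1Lam a h i m y * (y k - hcpSite a h q k))) (p1RealCell a h i) volume :=
    integrable_finsetSum _ fun k _ => i1 k
  have i2r : ∀ k : Fin 3, IntegrableOn (fun y => ∑ l : Fin 3, C k l * (p1Lam a h i m y * ((y k - hcpSite a h q k) * (y l - hcpSite a h q l))))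
      (p1RealCell a h i) volume := fun k => integrable_finsetSum _ fun l _ => i2 k l
  have i2s : IntegrableOn (fun y => ∑ k : Fin 3, ∑ l : Fin 3, C k l * (p1Lam a h i m y * ((y k - hcpSite a h q k) * (y l - hcpSite a h q l))))
      (p1RealCell a h i) volume := integrable_finsetSum _ fun k _ => i2r k
  have i01 : IntegrableOn (fun y => c₀ * p1Lam a h i m y + ∑ k : Fin 3, c₁ k * (p1Lam a h i m y * (y k - hcpSite a h q k)))
      (p1RealCell a h i) volume := i0.add i1s
  rw [integral_add i01 i2s, integral_add i0 i1s, integral_const_mul,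
    integral_finsetSum _ (fun k _ => i1 k), integral_finsetSum _ (fun k _ => i2r k)]
  congr 1
  · congr 1
    refine Finset.sum_congr rfl fun k _ => ?_
    rw [integral_const_mul]
  · refine Finset.sum_congr rfl fun k _ => ?_
    rw [integral_finsetSum _ (fun l _ => i2 k l)]
    refine Finset.sum_congr rfl fun l _ => ?_
    rw [integral_const_mul]

/-- **THE POLYNOMIAL STAR INTEGRAL**: for `e = y − y_q`,
`Σ_{incidences} ∫_T λ_q(y)(c₀ + ⟪c₁,e⟫ + eᵀCe) dy = c₀·V + (√3a²h/240)·⟪c₁, W(q)⟫ + V·Σ_{k,l} C_{kl} Σ₂,kl`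
with `V = √3a²h/2`, `W(q) = ±(10a, −(10√3/3)a, 0)` (part 25) and `Σ₂` the exact second-moment matrix (part 25c).
NOT a proof of H12⋆, NOT summit progress. -/
theorem p1Star_setIntegral_poly {a h : ℝ} (ha : 0 < a) (hh : 0 < h) (q : ℤ × ℤ × ℤ) (c₀ : ℝ) (c₁ : Fin 3 → ℝ) (C : Fin 3 → Fin 3 → ℝ) :
    (∑ o ∈ p1Corners, ∑ π : Fin 6, ∑ m : Fin 4,
        if p1VertOff (p1Par (q - o)) π m = o then ∫ y in p1RealCell a h (q - o, π), p1Lam a h (q - o, π) m y *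
          (c₀ + fpDot c₁ (fun k => y k - hcpSite a h q k) + p1Quad3 C (fun k => y k - hcpSite a h q k)) else 0) =
      c₀ * (√3 * a ^ 2 * h / 2) +
      ∑ k : Fin 3, c₁ k * (√3 * a ^ 2 * h / 240 *
        (if Even q.1 then (![10 * a, -(10 * √3 / 3) * a, 0] : Fin 3 → ℝ) k else (![-(10 * a), 10 * √3 / 3 * a, 0] : Fin 3 → ℝ) k)) +
      ∑ k : Fin 3, ∑ l : Fin 3, C k l * (√3 * a ^ 2 * h / 2 *
        (!![a ^ 2 / 8, -(√3 / 72) * a ^ 2, 0; -(√3 / 72) * a ^ 2, 7 * a ^ 2 / 72, 0; 0, 0, h ^ 2 / 6] : Matrix (Fin 3) (Fin 3) ℝ) k l) := by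
  have hcell : ∀ (o : ℤ × ℤ × ℤ) (π : Fin 6) (m : Fin 4),
      (if p1VertOff (p1Par (q - o)) π m = o then ∫ y in p1RealCell a h (q - o, π), p1Lam a h (q - o, π) m y *
          (c₀ + fpDot c₁ (fun k => y k - hcpSite a h q k) + p1Quad3 C (fun k => y k - hcpSite a h q k)) else 0) =
      if p1VertOff (p1Par (q - o)) π m = o then
        (c₀ * (∫ y in p1RealCell a h (q - o, π), p1Lam a h (q - o, π) m y) +
          ∑ k : Fin 3, c₁ k * (∫ y in p1RealCell a h (q - o, π), p1Lam a h (q - o, π) m y * (y k - hcpSite a h q k))) +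
        ∑ k : Fin 3, ∑ l : Fin 3, C k l * (∫ y in p1RealCell a h (q - o, π),
          p1Lam a h (q - o, π) m y * ((y k - hcpSite a h q k) * (y l - hcpSite a h q l))) else 0 := by
    intro o π m
    split_ifs
    · exact setIntegral_p1Lam_mul_poly ha hh q (q - o, π) m c₀ c₁ C
    · rfl
  rw [Finset.sum_congr rfl fun o _ => Finset.sum_congr rfl fun π _ => Finset.sum_congr rfl fun m _ => hcell o π m]
  refine (p1Star_sum_add q _ _).trans ?_
  congr 1
  · refine (p1Star_sum_add q _ _).trans ?_
    congr 1
    · exact (p1Star_sum_const_mul q c₀ _).trans (by rw [p1Hat_mass ha hh q])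
    · refine (p1Star_sum_finsum Finset.univ q _).trans (Finset.sum_congr rfl fun k _ => ?_)
      exact (p1Star_sum_const_mul q (c₁ k) _).trans (by rw [p1Hat_firstMoment ha hh q k])
  · refine (p1Star_sum_finsum Finset.univ q _).trans (Finset.sum_congr rfl fun k _ => ?_)
    refine (p1Star_sum_finsum Finset.univ q _).trans (Finset.sum_congr rfl fun l _ => ?_)
    exact (p1Star_sum_const_mul q (C k l) _).trans (by rw [p1Hat_secondMoment ha hh q k l])

/-! ## `p1SiteBare` on constant lattice values is a star integral -/

/-- For constant lattice values `V ≡ z`, `p1SiteBare a h W V q` is the star integral of `y ↦ q_{W(y)}(z)`. -/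
theorem p1SiteBare_const_eq_star (a h : ℝ) (W : (Fin 3 → ℝ) → Fin 3 → Fin 3 → ℝ) (z : Fin 3 → ℝ) (q : ℤ × ℤ × ℤ) :
    p1SiteBare a h W (fun _ => z) q =
      ∑ o ∈ p1Corners, ∑ π : Fin 6, ∑ m : Fin 4,
        if p1VertOff (p1Par (q - o)) π m = o then ∫ y in p1RealCell a h (q - o, π), p1Lam a h (q - o, π) m y * p1Quad3 (W y) z else 0 := by
  unfold p1SiteBare p1CellBare p1CellVals
  rfl

end Summit.AtomisticToContinuum.Crystallization.Theorems.StrictSplittingRuleBirth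

end
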